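import Literature.MathematicalPhysics.QuantumFieldTheory.Balaban1983to89.B8LeafModelZd3P

/-!
# `Balaban1983to89.B8LeafModelZd3P2` — EDITION δ₂ OF NODE 00's [B8] P-CARRIER: THE HÖLDER MEMBER OF (1.36) ∕ (1.39) READ «ON Ω_j» (BOTH POINTS OF THE PAIR
# IN Ω_j, [Balaban1985BackgroundPropagators] (3.40)), additive «deprecate-and-add»: `zdGF3P₂` = n05-w1's `B8LeafModelZd3P.zdGF3P` with the THIRD clause of `C136`
# («‖∇_{U₀}A‖_{1,β} ≤ B₂(β₀)(α₀+α₁) on Ω_j», the Hölder member) taken over the pair class `q.2.2 ∈ AdmPair η len ∧ q.2.2.1 ∈ Ω j ∧ q.2.2.2 ∈ Ω j` instead of the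
# tree's first-point class `… ∧ q.2.2.1 ∈ Ω j`; `zdGF3HP₂` = the same with Theorem 8's source space as printed.  Every other field is `zdGF3P`'s ∕ `zdGF3HP`'s by
# `rfl`; Theorem 4's body, Proposition 7 and every `C136`-free sentence transfer by `Iff.rfl`; OLD ⇒ NEW for bounded families (no converse).

statement-level skeleton of published theorems with citation tags; ONE PAIR of carrier definitions + `rfl` bookkeeping; nothing here is a claim about the
Yang–Mills mass gap

T. Bałaban, *Spaces of regular gauge field configurations on a lattice and gauge fixing conditions*, Commun. Math. Phys. **99** (1985) 75–102
`[Balaban1985RegularSpaces]` ("B8"; journal page = PDF page + 74; PDF held `paper:balaban1985-cmp99-regular-spaces-gauge-fixing`): (1.36) p. 82 «… ≤ B₂(β₀)(α₀+α₁)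
on Ω_j, j = 0, 1, …, k», (1.39) p. 83 «on Ω_j», Prop. 3 p. 87 («U₁ satisfies (1.36)–(1.39) with B₁ = 5dLB₀, B₂(β₀) = 5dLB₀(β₀), where B₀, B₀(β₀) are the constants of
Theorem 3.3 of [4]»), (1.59) p. 86, Thm 2 p. 83, Thm 4 p. 88, Thm 8 (1.146) p. 101.  T. Bałaban, *Propagators for lattice gauge theories in a background field*,
Commun. Math. Phys. **99** (1985) 389–434 `[Balaban1985BackgroundPropagators]` ("[4]"), (3.40) p. 397 (the Hölder seminorm `‖·‖_{β}` of a function ON a domain: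
both points of the pair in the domain), Thm 3.3 p. 398 with (3.42)–(3.43).

## WHY THIS FILE (cell `pub-ymgap`, HUMAN RULING D-0062 ∕ D-0149; DAG node N05 = [B8]; seat `pub-ymgap-dag-n05-d` g11; definition lane, count-neutral)

LOCATED NARROWNESS №4 of the typed [B8] objects (dag-n06-w2 g2 L-H1 ∕ dag-n06-b g17 WORD-δ₂, cell bus 2026-08-28 02:09Z; dag-n05-d g11 WORDS-1 (W3) 02:35Z):
the Hölder member of (1.36) is printed «on Ω_j» — [4]'s (3.40) seminorm of a function on the domain Ω_j, i.e. over pairs with BOTH points in Ω_j — and [4]'s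
Theorem 3.3 ((3.42)–(3.43)) supplies exactly that class; a pair `(x, x′)` with `x ∈ Ω_j` and `x′` adjacent outside is NOT `k`-uniformly bounded at the level-`j`
weight `(Lʲη)^{2+β}` (only level-`j′ < j` control of `∇A` at `x′`).  The tree's carrier `B8LeafModelZd3.zdGF3` (:189) types the member over the FIRST-POINT class
`q.2.2 ∈ AdmPair i.η len ∧ q.2.2.1 ∈ i.Ω j`, inherited by n05-w1's P-carrier `zdGF3P` ∕ `zdGF3HP` by `rfl` (`zdGF3P_C136`), and the Prop.-3-frame b9 socket
`B8LeafModelZd3.SockB9P3` (:373) types line 5 of (1.59) over the same class — STRONGER than print on a DISPLAYED-ONLY clause: NO consumer in the tree reads the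
Hölder member (the [B8] leaf reads `C136` through its first clause only — `B8.lean` :585 `C136 → C162`, :840 `h169_of_c136`; `B8Ineq132.InAk` = (1.7) ∕ (1.9) has no
Hölder line; n05-w1's estimate `B8Prop3KLevelGamma.prop3_fifth_kLevel_γ` is class-agnostic), so the class enters at exactly two literals that must AGREE — the
carrier field and the socket's line 5.  dag-n06-b's `B9SupplySockB9P3ZdGammaUnivDelta2` (p59xxxx, 2026-08-28) lands the both-points socket `SockB9P3H2` and its
univ-road member supplier `sockB9P3PIδ2_at_univ` at exactly the N05 knits' `Ω₀ = ℤᵈ` law members; to CONSUME it by name the carrier's Hölder clause must be read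
on print's class.  An in-place edit of `zdGF3` ∕ `zdGF3P` is not fileable (≈ 40 modules import them), hence the sibling definitions here — letter for letter
n05-w1's `B8LeafModelZd3P` pattern (which did the same for the (1.35) ∕ (1.37) ∕ (1.42) letters, located narrowness №3).  The knits re-target THIS carrier by
token swap (`zdGF3P ↦ zdGF3P₂`, `zdGF3HP ↦ zdGF3HP₂`, `SockB9P3 ↦ SockB9P3H2`; the sourced socket's line 5 likewise), NODE 00 re-pins the slot — the planners' ∕
node00-def's call, not this file's.

## WHAT IS DECLARED ∕ PROVED (kernel, 0 sorry; axioms `propext` ∕ `Classical.choice` ∕ `Quot.sound`)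

* §1 **`zdGF3P₂ 𝔸 L β len i`** := `{ zdGF3P 𝔸 L β len i with C136 := … }` — clauses 1 ((1.36)₁ pointwise on the logarithm) and 2 (`|∇_{U₀}A|₍₋₂₎ ≤ B₁s`) VERBATIM,
  clause 3 (the Hölder member `‖∇_{U₀}A‖_{1,β} ≤ B₂s`) over the class `q.2.2 ∈ AdmPair i.η len ∧ q.2.2.1 ∈ i.Ω j ∧ q.2.2.2 ∈ i.Ω j`; `zdGF3P₂_C136_iff` (`Iff.rfl`) and
  the `rfl` faces `zdGF3P₂_toGFData_*`-free fields: `_Cfg _Pert _GT _Src _k _InA _Reg335 _InAAx _avgClose _avgClose166 _Restricted _act _C137 _Landau _C139 _C162 _fNorm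
  _LandauF _InAPair _fGrad _C140 _InR` (each `= zdGF3P`'s).
* §2 **`zdGF3HP₂ 𝔸 L β len i`** := `{ zdGF3P₂ 𝔸 L β len i with InR := (zdGF3H 𝔸 L β len i).InR }`; `zdGF3HP₂_toGFData2 : (zdGF3HP₂ …).toGFData2 = (zdGF3P₂ …).toGFData2`
  (`rfl`), `zdGF3HP₂_InR` (`= zdGF3HP`'s), `zdGF3HP₂_C136`, `inR_zdGF3HP₂_iff`.
* §3 TRANSFERS (`Iff.rfl`): the `C136`-free sentences of the [B8] leaf are THE SAME on the two carriers — `thm4Body_zdGF3P₂_iff` ∕ `thm4Printed_zdGF3P₂_iff`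
  (`B8.Thm4Body ∕ Thm4Printed` over any index map), `prop7PrintedR_zdGF3HP₂_iff` (`B8SectGH.Prop7PrintedR`), `prop7RepairedC_zdGF3HP₂_iff`.
* §4 THE HONEST REMARK, OLD ⇒ NEW (no converse): `zdGF3P₂_C136_of_zdGF3P` — for a BOUNDED weighted Hölder family (`B8ScaledSupNorm.Bdd`, the real-`iSup` side
  condition; finite lattices in print) the first-point bound implies the both-points bound (`B8ScaledSupNorm.msup_mono_mem`: the class shrinks).

## HONEST SCOPE

Definitions and `rfl` ∕ monotonicity bookkeeping ONLY; nothing of [Balaban1985RegularSpaces] is asserted or discharged; the re-targeted knits (Prop. 3, Thm 2,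
Thm 8 surviving, the slot) are OTHER files' content; which carrier NODE 00 pins is the planners' call.  N05 NOT discharged; count-neutral; one finite 𝕋⁴ programme
at fixed ε, Bałaban AS PRINTED; NOT continuum ∕ ℝ⁴ ∕ infinite volume ∕ OS ∕ mass gap ∕ Clay.  No `sorry`, no `axiom`, no `instance`, no `notation`.
Unit `pub-ymgap-dag-n05-d` (g11), 2026-08-28.
-/

noncomputable section

open NormedSpace

namespace Literature.MathematicalPhysics.QuantumFieldTheory.Balaban1983to89.B8LeafModelZd3P2

open B7Prop1Explicit (e)
open B7Prop1Local (InBox loK bondHiK)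
open B7Prop2Explicit (unitaryUnits avgIter)
open B7Prop4GeneralLevels (logCovIter)
open B8Lemma1NonAbelian (mulCfg)
open B8Eq140Level (SideTouches)
open B8Ineq132 (covDerivFwd)
open B8Eq184Proof (cfgExp)
open B8Eq146AExpansion (iEta)
open B8LeafModelZd (ZdIdx)
open B8LeafModelZd3 (zdGF3 mlogCfg)
open B8Eq138LandauZd (logCfg)
open B8LeafModelZd3H (zdGF3H)
open B8LeafModelZd3P (zdGF3P zdGF3HP)
open B8ScaledSupNorm (msup Bdd)
open B9Eq340HolderZd (hquot AdmPair)

-- `Site` alone could resolve to the torus sites of `Setup.lean`; re-export the `ℤ^d` sites of `B7Prop1Explicit`.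
export B7Prop1Explicit (Site)

variable {d : ℕ}

/-! ## §1 The P-carrier, edition δ₂: the Hölder member of (1.36) on Ω_j × Ω_j pairs; `rfl` faces -/

section Family

variable (𝔸 : Type) [CStarAlgebra 𝔸] (L : ℕ) (β : ℝ) (len : Site d → ℝ)

/-- **NODE 00's [B8] P-member with the Hölder member of (1.36) read as printed, «on Ω_j»**: n05-w1's `zdGF3P 𝔸 L β len i` with `C136 B₁ B₂ s U₀ U₁` := (1.36)₁
pointwise on the logarithm (verbatim) `∧` `|∇_{U₀}A|₍₋₂₎ ≤ B₁s` (verbatim) `∧` the Hölder member `sup_j sup (Lʲη)^{2+β}·|∇_{U₀}A(x) − U(…)∇_{U₀}A(x′)|∕|x−x′|^β ≤ B₂s`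
over the pairs `(x, x′)` with `|x − x′| ≤ 1` AND BOTH `x, x′ ∈ Ω_j` ([4] (3.40): the seminorm of a function on the domain Ω_j); all other fields verbatim
(hence `rfl`-equal). [cite: Balaban1985RegularSpaces, (1.36) p.82, (1.39) p.83, Prop. 3 p.87; Balaban1985BackgroundPropagators, (3.40) p.397] -/
def zdGF3P₂ (i : ZdIdx d L) : B8SectGH.GFData3 :=
  { zdGF3P 𝔸 L β len i with
    C136 := fun B₁ B₂ s U₀ P =>
      (∀ j, j ≤ i.k → ∀ b ∈ {b : Site d × Fin d | SideTouches (i.Ω j) b.1 b.2},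
        P.2.1 b.1 b.2 = cfgExp i.η (logCfg i.η P.2.1) b.1 b.2 ∧ IsSelfAdjoint (logCfg i.η P.2.1 b.1 b.2) ∧
          ‖logCfg i.η P.2.1 b.1 b.2‖ ≤ B₁ * s * ((L : ℝ) ^ j * i.η)⁻¹) ∧
      msup L i.k i.η (-(2 : ℝ)) (fun j (t : Fin d × Fin d × Site d) => SideTouches (i.Ω j) t.2.2 t.2.1)
          (fun t => covDerivFwd i.η U₀.1 t.1 (fun z => mlogCfg i.k i.η i.Ω P.2.1 z t.2.1) t.2.2) ≤ B₁ * s ∧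
      msup L i.k i.η (-(2 + β)) (fun j (q : Fin d × Fin d × (Site d × Site d)) => q.2.2 ∈ AdmPair i.η len ∧ q.2.2.1 ∈ i.Ω j ∧ q.2.2.2 ∈ i.Ω j)
          (fun q => hquot i.η β len U₀.1 (covDerivFwd i.η U₀.1 q.1 (fun z => mlogCfg i.k i.η i.Ω P.2.1 z q.2.1)) q.2.2) ≤ B₂ * s }

variable {𝔸 L β len}

/-- **The edition-δ₂ (1.36) letter, unfolded** (`Iff.rfl`). [cite: Balaban1985RegularSpaces, (1.36) p.82; Balaban1985BackgroundPropagators, (3.40) p.397] -/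
theorem zdGF3P₂_C136_iff (i : ZdIdx d L) (B₁ B₂ s : ℝ) (U₀ : (zdGF3P₂ 𝔸 L β len i).Cfg) (P : (zdGF3P₂ 𝔸 L β len i).Pert) :
    (zdGF3P₂ 𝔸 L β len i).C136 B₁ B₂ s U₀ P ↔
      (∀ j, j ≤ i.k → ∀ b ∈ {b : Site d × Fin d | SideTouches (i.Ω j) b.1 b.2},
        P.2.1 b.1 b.2 = cfgExp i.η (logCfg i.η P.2.1) b.1 b.2 ∧ IsSelfAdjoint (logCfg i.η P.2.1 b.1 b.2) ∧
          ‖logCfg i.η P.2.1 b.1 b.2‖ ≤ B₁ * s * ((L : ℝ) ^ j * i.η)⁻¹) ∧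
      msup L i.k i.η (-(2 : ℝ)) (fun j (t : Fin d × Fin d × Site d) => SideTouches (i.Ω j) t.2.2 t.2.1)
          (fun t => covDerivFwd i.η U₀.1 t.1 (fun z => mlogCfg i.k i.η i.Ω P.2.1 z t.2.1) t.2.2) ≤ B₁ * s ∧
      msup L i.k i.η (-(2 + β)) (fun j (q : Fin d × Fin d × (Site d × Site d)) => q.2.2 ∈ AdmPair i.η len ∧ q.2.2.1 ∈ i.Ω j ∧ q.2.2.2 ∈ i.Ω j)
          (fun q => hquot i.η β len U₀.1 (covDerivFwd i.η U₀.1 q.1 (fun z => mlogCfg i.k i.η i.Ω P.2.1 z q.2.1)) q.2.2) ≤ B₂ * s :=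
  Iff.rfl

/-- `Cfg` unchanged (`rfl`). [cite: Balaban1985RegularSpaces, p.82 (bookkeeping)] -/
theorem zdGF3P₂_Cfg (i : ZdIdx d L) : (zdGF3P₂ 𝔸 L β len i).Cfg = (zdGF3P 𝔸 L β len i).Cfg := rfl
/-- `Pert` unchanged (`rfl`). [cite: Balaban1985RegularSpaces, p.82 (bookkeeping)] -/
theorem zdGF3P₂_Pert (i : ZdIdx d L) : (zdGF3P₂ 𝔸 L β len i).Pert = (zdGF3P 𝔸 L β len i).Pert := rfl
/-- `GT` unchanged (`rfl`). [cite: Balaban1985RegularSpaces, (1.29) p.81 (bookkeeping)] -/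
theorem zdGF3P₂_GT (i : ZdIdx d L) : (zdGF3P₂ 𝔸 L β len i).GT = (zdGF3P 𝔸 L β len i).GT := rfl
/-- `Src` unchanged (`rfl`). [cite: Balaban1985RegularSpaces, Thm 8 p.101 (bookkeeping)] -/
theorem zdGF3P₂_Src (i : ZdIdx d L) : (zdGF3P₂ 𝔸 L β len i).Src = (zdGF3P 𝔸 L β len i).Src := rfl
/-- `k` unchanged (`rfl`). [cite: Balaban1985RegularSpaces, p.77 (bookkeeping)] -/
theorem zdGF3P₂_k (i : ZdIdx d L) : (zdGF3P₂ 𝔸 L β len i).k = (zdGF3P 𝔸 L β len i).k := rfl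
/-- (1.33) `InA` unchanged (`rfl`). [cite: Balaban1985RegularSpaces, (1.33) p.82 (bookkeeping)] -/
theorem zdGF3P₂_InA (i : ZdIdx d L) : (zdGF3P₂ 𝔸 L β len i).InA = (zdGF3P 𝔸 L β len i).InA := rfl
/-- `Reg335` unchanged (`rfl`). [cite: Balaban1985RegularSpaces, (1.33) p.82 (bookkeeping)] -/
theorem zdGF3P₂_Reg335 (i : ZdIdx d L) : (zdGF3P₂ 𝔸 L β len i).Reg335 = (zdGF3P 𝔸 L β len i).Reg335 := rfl
/-- (1.34) `InAAx` unchanged (`rfl`). [cite: Balaban1985RegularSpaces, (1.34) p.82 (bookkeeping)] -/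
theorem zdGF3P₂_InAAx (i : ZdIdx d L) : (zdGF3P₂ 𝔸 L β len i).InAAx = (zdGF3P 𝔸 L β len i).InAAx := rfl
/-- (1.35) `avgClose` unchanged — the P-carrier's one-end-point letter (`rfl`). [cite: Balaban1985RegularSpaces, (1.35) p.82 (bookkeeping)] -/
theorem zdGF3P₂_avgClose (i : ZdIdx d L) : (zdGF3P₂ 𝔸 L β len i).avgClose = (zdGF3P 𝔸 L β len i).avgClose := rfl
/-- (1.66) `avgClose166` unchanged (`rfl`). [cite: Balaban1985RegularSpaces, (1.66) p.88 (bookkeeping)] -/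
theorem zdGF3P₂_avgClose166 (i : ZdIdx d L) : (zdGF3P₂ 𝔸 L β len i).avgClose166 = (zdGF3P 𝔸 L β len i).avgClose166 := rfl
/-- (1.29) `Restricted` unchanged (`rfl`). [cite: Balaban1985RegularSpaces, (1.29) p.81 (bookkeeping)] -/
theorem zdGF3P₂_Restricted (i : ZdIdx d L) : (zdGF3P₂ 𝔸 L β len i).Restricted = (zdGF3P 𝔸 L β len i).Restricted := rfl
/-- `act` unchanged (`rfl`). [cite: Balaban1985RegularSpaces, (1.17) p.78 (bookkeeping)] -/
theorem zdGF3P₂_act (i : ZdIdx d L) : (zdGF3P₂ 𝔸 L β len i).act = (zdGF3P 𝔸 L β len i).act := rfl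
/-- (1.37) `C137` unchanged — the P-carrier's letter over print's class `towerBondsP` (`rfl`). [cite: Balaban1985RegularSpaces, (1.37) p.82, (1.31) p.82 (bookkeeping)] -/
theorem zdGF3P₂_C137 (i : ZdIdx d L) : (zdGF3P₂ 𝔸 L β len i).C137 = (zdGF3P 𝔸 L β len i).C137 := rfl
/-- (1.38) `Landau` unchanged (`rfl`). [cite: Balaban1985RegularSpaces, (1.38) p.83 (bookkeeping)] -/
theorem zdGF3P₂_Landau (i : ZdIdx d L) : (zdGF3P₂ 𝔸 L β len i).Landau = (zdGF3P 𝔸 L β len i).Landau := rfl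
/-- (1.39) `C139` unchanged (`rfl`). [cite: Balaban1985RegularSpaces, (1.39) p.83 (bookkeeping)] -/
theorem zdGF3P₂_C139 (i : ZdIdx d L) : (zdGF3P₂ 𝔸 L β len i).C139 = (zdGF3P 𝔸 L β len i).C139 := rfl
/-- (1.62) `C162` unchanged (`rfl`). [cite: Balaban1985RegularSpaces, (1.62) p.87 (bookkeeping)] -/
theorem zdGF3P₂_C162 (i : ZdIdx d L) : (zdGF3P₂ 𝔸 L β len i).C162 = (zdGF3P 𝔸 L β len i).C162 := rfl
/-- `fNorm` unchanged (`rfl`). [cite: Balaban1985RegularSpaces, Thm 8 p.101 (bookkeeping)] -/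
theorem zdGF3P₂_fNorm (i : ZdIdx d L) : (zdGF3P₂ 𝔸 L β len i).fNorm = (zdGF3P 𝔸 L β len i).fNorm := rfl
/-- (1.146) `LandauF` unchanged (`rfl`). [cite: Balaban1985RegularSpaces, (1.146) p.101 (bookkeeping)] -/
theorem zdGF3P₂_LandauF (i : ZdIdx d L) : (zdGF3P₂ 𝔸 L β len i).LandauF = (zdGF3P 𝔸 L β len i).LandauF := rfl
/-- (1.40)₂ `InAPair` unchanged (`rfl`). [cite: Balaban1985RegularSpaces, (1.40) p.83 (bookkeeping)] -/
theorem zdGF3P₂_InAPair (i : ZdIdx d L) : (zdGF3P₂ 𝔸 L β len i).InAPair = (zdGF3P 𝔸 L β len i).InAPair := rfl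
/-- `fGrad` unchanged (`rfl`). [cite: Balaban1985RegularSpaces, Thm 8 p.101 (bookkeeping)] -/
theorem zdGF3P₂_fGrad (i : ZdIdx d L) : (zdGF3P₂ 𝔸 L β len i).fGrad = (zdGF3P 𝔸 L β len i).fGrad := rfl
/-- (1.140) `C140` unchanged (`rfl`). [cite: Balaban1985RegularSpaces, (1.140) p.100 (bookkeeping)] -/
theorem zdGF3P₂_C140 (i : ZdIdx d L) : (zdGF3P₂ 𝔸 L β len i).C140 = (zdGF3P 𝔸 L β len i).C140 := rfl
/-- `InR` unchanged (`rfl`; = `zdGF3`'s). [cite: Balaban1985RegularSpaces, Thm 8 p.101 (bookkeeping)] -/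
theorem zdGF3P₂_InR (i : ZdIdx d L) : (zdGF3P₂ 𝔸 L β len i).InR = (zdGF3P 𝔸 L β len i).InR := rfl

end Family

/-! ## §2 Edition δ₂ with Theorem 8's source space as printed: `zdGF3HP₂` -/

section FamilyH

variable (𝔸 : Type) [CStarAlgebra 𝔸] (L : ℕ) (β : ℝ) (len : Site d → ℝ)

/-- **Edition δ₂ of the pinned carrier `zdGF3HP`**: `zdGF3P₂` with the ONE field `InR` replaced by `zdGF3H`'s (Theorem 8's «`f ∈ R(U₀)`» as printed: `InR138 ∧`
Hermitian `∧` supported in `Ω₀ ∧` finite `|f|₍₋₂₎`) — i.e. n05-w1's `zdGF3HP` with the Hölder member of (1.36) on Ω_j × Ω_j pairs.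
[cite: Balaban1985RegularSpaces, Thm 8 (1.146) p.101, (1.36) p.82; Balaban1985BackgroundPropagators, (3.40) p.397] -/
def zdGF3HP₂ (i : ZdIdx d L) : B8SectGH.GFData3 :=
  { zdGF3P₂ 𝔸 L β len i with InR := (zdGF3H 𝔸 L β len i).InR }

variable {𝔸 L β len}

/-- The `GFData2` part of `zdGF3HP₂` IS `zdGF3P₂`'s (`rfl`). [cite: Balaban1985RegularSpaces, (1.33)–(1.40) pp.82–83 (bookkeeping)] -/
theorem zdGF3HP₂_toGFData2 (i : ZdIdx d L) : (zdGF3HP₂ 𝔸 L β len i).toGFData2 = (zdGF3P₂ 𝔸 L β len i).toGFData2 := rfl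

/-- The `GFData` part of `zdGF3HP₂` IS `zdGF3P₂`'s (`rfl`). [cite: Balaban1985RegularSpaces, (1.33)–(1.39) p.82 (bookkeeping)] -/
theorem zdGF3HP₂_toGFData (i : ZdIdx d L) : (zdGF3HP₂ 𝔸 L β len i).toGFData = (zdGF3P₂ 𝔸 L β len i).toGFData := rfl

/-- Theorem 8's `InR` of `zdGF3HP₂` IS `zdGF3HP`'s (`rfl`). [cite: Balaban1985RegularSpaces, Thm 8 (1.146) p.101 (bookkeeping)] -/
theorem zdGF3HP₂_InR (i : ZdIdx d L) : (zdGF3HP₂ 𝔸 L β len i).InR = (zdGF3HP 𝔸 L β len i).InR := rfl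

/-- The (1.36) letter of `zdGF3HP₂` IS `zdGF3P₂`'s edition-δ₂ letter (`rfl`). [cite: Balaban1985RegularSpaces, (1.36) p.82 (bookkeeping)] -/
theorem zdGF3HP₂_C136 (i : ZdIdx d L) : (zdGF3HP₂ 𝔸 L β len i).C136 = (zdGF3P₂ 𝔸 L β len i).C136 := rfl

/-- (1.37) of `zdGF3HP₂` IS `zdGF3HP`'s (`rfl`). [cite: Balaban1985RegularSpaces, (1.37) p.82 (bookkeeping)] -/
theorem zdGF3HP₂_C137 (i : ZdIdx d L) : (zdGF3HP₂ 𝔸 L β len i).C137 = (zdGF3HP 𝔸 L β len i).C137 := rfl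

/-- (1.35) of `zdGF3HP₂` IS `zdGF3HP`'s (`rfl`). [cite: Balaban1985RegularSpaces, (1.35) p.82 (bookkeeping)] -/
theorem zdGF3HP₂_avgClose (i : ZdIdx d L) : (zdGF3HP₂ 𝔸 L β len i).avgClose = (zdGF3HP 𝔸 L β len i).avgClose := rfl

/-- (1.66) of `zdGF3HP₂` IS `zdGF3HP`'s (`rfl`). [cite: Balaban1985RegularSpaces, (1.66) p.88 (bookkeeping)] -/
theorem zdGF3HP₂_avgClose166 (i : ZdIdx d L) : (zdGF3HP₂ 𝔸 L β len i).avgClose166 = (zdGF3HP 𝔸 L β len i).avgClose166 := rfl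

/-- (1.140) of `zdGF3HP₂` IS `zdGF3HP`'s (`rfl`). [cite: Balaban1985RegularSpaces, (1.140) p.100 (bookkeeping)] -/
theorem zdGF3HP₂_C140 (i : ZdIdx d L) : (zdGF3HP₂ 𝔸 L β len i).C140 = (zdGF3HP 𝔸 L β len i).C140 := rfl

/-- **`InR` of `zdGF3HP₂`, unfolded** (`Iff.rfl`). [cite: Balaban1985RegularSpaces, Thm 8 (1.146) p.101] -/
theorem inR_zdGF3HP₂_iff (i : ZdIdx d L) (U₀ : (zdGF3HP₂ 𝔸 L β len i).Cfg) (f : Site d → 𝔸) :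
    (zdGF3HP₂ 𝔸 L β len i).InR U₀ f ↔ (zdGF3HP 𝔸 L β len i).InR U₀ f :=
  Iff.rfl

end FamilyH

/-! ## §3 Transfers: the `C136`-free sentences of the leaf are the same on the two editions -/

section Transfer

variable {𝔸 : Type} [CStarAlgebra 𝔸] {L : ℕ} {β : ℝ} {len : Site d → ℝ}

/-- **Theorem 4's body does not read (1.36)**: `B8.Thm4Body` on `zdGF3P₂ ∘ ι` IS `B8.Thm4Body` on `zdGF3P ∘ ι` (`Iff.rfl`), for every index map `ι`.
[cite: Balaban1985RegularSpaces, Thm 4 p.88 (bookkeeping)] -/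
theorem thm4Body_zdGF3P₂_iff {J : Type} (ι : J → ZdIdx d L) (c₁ B₁' : ℝ) :
    B8.Thm4Body c₁ B₁' (fun a => (zdGF3P₂ 𝔸 L β len (ι a)).toGFData) ↔ B8.Thm4Body c₁ B₁' (fun a => (zdGF3P 𝔸 L β len (ι a)).toGFData) :=
  Iff.rfl

/-- **Theorem 4 as printed does not read (1.36)** (`Iff.rfl`). [cite: Balaban1985RegularSpaces, Thm 4 p.88 (bookkeeping)] -/
theorem thm4Printed_zdGF3P₂_iff {J : Type} (ι : J → ZdIdx d L) (B₁' : ℝ) :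
    B8.Thm4Printed B₁' (fun a => (zdGF3P₂ 𝔸 L β len (ι a)).toGFData) ↔ B8.Thm4Printed B₁' (fun a => (zdGF3P 𝔸 L β len (ι a)).toGFData) :=
  Iff.rfl

/-- The same for the `HP` editions (`toGFData` of `zdGF3HP₂` ∕ `zdGF3HP` are `zdGF3P₂`'s ∕ `zdGF3P`'s). [cite: Balaban1985RegularSpaces, Thm 4 p.88 (bookkeeping)] -/
theorem thm4Printed_zdGF3HP₂_iff {J : Type} (ι : J → ZdIdx d L) (B₁' : ℝ) :
    B8.Thm4Printed B₁' (fun a => (zdGF3HP₂ 𝔸 L β len (ι a)).toGFData) ↔ B8.Thm4Printed B₁' (fun a => (zdGF3HP 𝔸 L β len (ι a)).toGFData) :=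
  Iff.rfl

/-- **Proposition 7 (printed-R currency) does not read (1.36)** (`Iff.rfl`), for every index map and axial map.
[cite: Balaban1985RegularSpaces, Prop. 7 p.100 (bookkeeping)] -/
theorem prop7PrintedR_zdGF3HP₂_iff {J : Type} (ι : J → ZdIdx d L)
    (toAxial : ∀ a, (zdGF3HP 𝔸 L β len (ι a)).Cfg → (zdGF3HP 𝔸 L β len (ι a)).Pert → (zdGF3HP 𝔸 L β len (ι a)).Pert) :
    B8SectGH.Prop7PrintedR (fun a => zdGF3HP₂ 𝔸 L β len (ι a)) toAxial ↔ B8SectGH.Prop7PrintedR (fun a => zdGF3HP 𝔸 L β len (ι a)) toAxial :=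
  Iff.rfl

/-- **Proposition 7 (repaired-C currency) does not read (1.36)** (`Iff.rfl`). [cite: Balaban1985RegularSpaces, Prop. 7 (1.145) p.100 (bookkeeping)] -/
theorem prop7RepairedC_zdGF3HP₂_iff {J : Type} (ι : J → ZdIdx d L) (C : ℝ)
    (toAxial : ∀ a, (zdGF3HP 𝔸 L β len (ι a)).Cfg → (zdGF3HP 𝔸 L β len (ι a)).Pert → (zdGF3HP 𝔸 L β len (ι a)).Pert) :
    B8Ineq145.Prop7RepairedC C (fun a => zdGF3HP₂ 𝔸 L β len (ι a)) toAxial ↔ B8Ineq145.Prop7RepairedC C (fun a => zdGF3HP 𝔸 L β len (ι a)) toAxial :=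
  Iff.rfl

end Transfer

/-! ## §4 The honest remark: OLD ⇒ NEW for bounded families (no converse) -/

section Remark

variable {𝔸 : Type} [CStarAlgebra 𝔸] {L : ℕ} {β : ℝ} {len : Site d → ℝ}

/-- **OLD ⇒ NEW for the (1.36) letter**: the both-points class is CONTAINED in the first-point class, so — for a weighted Hölder family that is BOUNDED on the
larger class (the real-`iSup` side condition `B8ScaledSupNorm.Bdd`; automatic on print's finite lattices) — n05-w1's `zdGF3P` letter implies the edition-δ₂
letter (`msup_mono_mem`).  NO converse: a far pair `(x ∈ Ω_j, x′ ∉ Ω_j)` at the level-`j` weight is exactly what the printed class omits.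
[cite: Balaban1985RegularSpaces, (1.36) p.82; Balaban1985BackgroundPropagators, (3.40) p.397] -/
theorem zdGF3P₂_C136_of_zdGF3P (i : ZdIdx d L) {B₁ B₂ s : ℝ} {U₀ : (zdGF3P 𝔸 L β len i).Cfg} {P : (zdGF3P 𝔸 L β len i).Pert}
    (hB : Bdd L i.k i.η (-(2 + β)) (fun j (q : Fin d × Fin d × (Site d × Site d)) => q.2.2 ∈ AdmPair i.η len ∧ q.2.2.1 ∈ i.Ω j)
      (fun q => hquot i.η β len U₀.1 (covDerivFwd i.η U₀.1 q.1 (fun z => mlogCfg i.k i.η i.Ω P.2.1 z q.2.1)) q.2.2))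
    (h : (zdGF3P 𝔸 L β len i).C136 B₁ B₂ s U₀ P) : (zdGF3P₂ 𝔸 L β len i).C136 B₁ B₂ s U₀ P := by
  obtain ⟨h1, h2, h3⟩ := h
  refine ⟨h1, h2, le_trans ?_ h3⟩
  exact B8ScaledSupNorm.msup_mono_mem le_rfl i.hη.le (fun j q hq => ⟨hq.1, hq.2.1⟩) hB

end Remark

end Literature.MathematicalPhysics.QuantumFieldTheory.Balaban1983to89.B8LeafModelZd3P2

end
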